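import Mathlib
import Summits.CriticalPhenomena.Ising3DConformalLimit.Theses.MarkovRigidity
import Summits.CriticalPhenomena.Ising3DConformalLimit.Theorems.EnergyNotSigmaSquaredMoebiusLimitExistsDefs
import Literature.MathematicalPhysics.QuantumLattice.GermMarkov
import HarnessLib

/-!
# Crux `GaussianLimitIsFree` (item stmt-CriticalPhenomena-2601), line `registered` (birth v4):
# the open stub `stub_markovInheritance` FOLLOWS from crux stmt-CriticalPhenomena-11236
# (`MarkovRigidity.MarkovInheritance`)

THEOREM-ONLY file (lead c2).  The skeleton of the line (Cruxes/GaussianLimitIsFree/Lines/birth.lean, v4)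
is closed modulo two stubs: Rozanov's spectral Markov criterion (a Literature named fact) and
`stub_markovInheritance` — "the Gaussian law realising a `U₄`-free pointwise scaling limit of the critical
`ℤ³` correlators is germ-Markov for every open ball" (Kotani's Def. 1 / Rozanov's (3.14) at `T = ball c r`,
in the splitting form `CondIndepCondExp` of `GermMarkov.lean`).  This file proves that stub from the
statement of the crux `MarkovInheritance` of route `MarkovRigidity` (item stmt-CriticalPhenomena-11236,
OPEN), which asserts the Markov property of that law for every open ball and open half-space in McKean's
one-sided form `E[F | 𝒜₊(Uᶜ) ∨ 𝒜₊(∂U)] = E[F | 𝒜₊(∂U)]` for bounded `𝒜₊(Ū)`-measurable `F`: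

* `condIndepCondExp_of_condExp_indicator_eq` — the general probabilistic step: if `m' ≤ m₂` and
  `μ⟦s | m₂⟧ = μ⟦s | m'⟧` a.e. for every `s ∈ m₁`, then `m'` splits `m₁` and `m₂` (tower and pull-out
  properties of the conditional expectation);
* `sig_eq_fieldSigma`, `germ_eq_germSigma` — the σ-algebras of item 11236 (`⨆` over test functions
  supported in `A`, `⨅` over `ε > 0` of the `ε`-thickenings) are the tree's `fieldSigma` / `germSigma`;
* `stub_markovInheritance_of_markovInheritance` — `MarkovInheritance → <registered signature of
  stub_markovInheritance>`.

Hence, with the landed stubs 1 and 3, crux 2601 is FORMALLY reduced to crux 11236 plus the Literature fact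
`InvSpectralDensityPolynomialOfGermMarkov` (Rozanov 1982, Ch. 3 §2.3).  References: Yu. A. Rozanov, *Markov
Random Fields* (1982), Ch. 2 §1.1 (splitting σ-algebras, (1.1)–(1.3)); H. P. McKean, Teor. Verojatn. Primen.
8 (1963).  No definitions are introduced.
-/

noncomputable section

namespace Summit.CriticalPhenomena.Ising3DConformalLimit.Cruxes.GaussianLimitIsFree.Birth

open MeasureTheory Filter Set
open scoped ProbabilityTheory Topology
open Literature.MathematicalPhysics.QuantumLattice

/-! ### The one-sided (McKean) form of the Markov property implies the splitting form -/

section Splitting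

variable {Ω : Type*} {m' m₁ m₂ mΩ : MeasurableSpace Ω} {μ : Measure Ω}

/-- **One-sided Markov ⟹ splitting** (Rozanov 1982, Ch. 2 §1.1, (1.1)⟺(1.3)): if `m' ≤ m₂ ≤ mΩ`,
`m₁ ≤ mΩ`, `μ` is finite and `μ⟦s | m₂⟧ = μ⟦s | m'⟧` a.e. for every `m₁`-measurable `s`, then `m'`
splits `m₁` and `m₂`: `μ⟦s ∩ t | m'⟧ = μ⟦s | m'⟧ · μ⟦t | m'⟧` a.e. for `s ∈ m₁`, `t ∈ m₂`. Proof: tower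
property through `m₂`, pull the `m₂`-measurable indicator of `t` out, substitute the hypothesis, pull the
`m'`-measurable factor `μ⟦s | m'⟧` out. [cite: Rozanov1982, Ch. 2 §1.1 (1.1)–(1.3)] -/
theorem condIndepCondExp_of_condExp_indicator_eq [IsFiniteMeasure μ] (hm' : m' ≤ mΩ)
    (hm₁ : m₁ ≤ mΩ) (hm₂ : m₂ ≤ mΩ) (hle : m' ≤ m₂)
    (h : ∀ s : Set Ω, MeasurableSet[m₁] s →
      μ[s.indicator (fun _ => (1 : ℝ)) | m₂] =ᵐ[μ] μ[s.indicator (fun _ => (1 : ℝ)) | m']) :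
    CondIndepCondExp m' m₁ m₂ μ := by
  intro s t hs ht
  have hsΩ : MeasurableSet s := hm₁ s hs
  have htΩ : MeasurableSet t := hm₂ t ht
  -- the indicators
  set fs : Ω → ℝ := s.indicator (fun _ => (1 : ℝ)) with hfs
  set ft : Ω → ℝ := t.indicator (fun _ => (1 : ℝ)) with hft
  have hfs_int : Integrable fs μ := (integrable_const (1 : ℝ)).indicator hsΩ
  have hft_int : Integrable ft μ := (integrable_const (1 : ℝ)).indicator htΩ
  have hft_meas : StronglyMeasurable[m₂] ft :=
    (stronglyMeasurable_const (b := (1 : ℝ))).indicator ht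
  have hft_bound : ∀ᵐ ω ∂μ, ‖ft ω‖ ≤ 1 := Eventually.of_forall fun ω => by
    rw [hft]
    by_cases hω : ω ∈ t <;> simp [Set.indicator, hω]
  have hinter : (s ∩ t).indicator (fun _ => (1 : ℝ)) = ft * fs := by
    funext ω
    simp only [Pi.mul_apply, hfs, hft]
    by_cases h1 : ω ∈ s <;> by_cases h2 : ω ∈ t <;> simp [h1, h2]
  haveI : SigmaFinite (μ.trim hm₂) := inferInstance
  -- Step 1: tower property through `m₂` and pull-out of the `m₂`-measurable indicator of `t`.
  have h1 : μ[(s ∩ t).indicator (fun _ => (1 : ℝ)) | m'] =ᵐ[μ] μ[ft * μ[fs | m₂] | m'] := by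
    rw [hinter]
    have htower : μ[μ[ft * fs | m₂] | m'] =ᵐ[μ] μ[ft * fs | m'] :=
      condExp_condExp_of_le hle hm₂
    have hpull : μ[ft * fs | m₂] =ᵐ[μ] ft * μ[fs | m₂] :=
      condExp_stronglyMeasurable_mul_of_bound hm₂ hft_meas hfs_int 1 hft_bound
    exact htower.symm.trans (condExp_congr_ae hpull)
  -- Step 2: substitute the one-sided Markov hypothesis `μ[fs | m₂] = μ[fs | m']`.
  have h2 : μ[ft * μ[fs | m₂] | m'] =ᵐ[μ] μ[ft * μ[fs | m'] | m'] :=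
    condExp_congr_ae (EventuallyEq.mul EventuallyEq.rfl (h s hs))
  -- Step 3: pull the `m'`-measurable factor `μ[fs | m']` out (it is bounded by `1` a.e.).
  have hcond_meas : StronglyMeasurable[m'] (μ[fs | m']) := stronglyMeasurable_condExp
  have hcond_bound : ∀ᵐ ω ∂μ, ‖(μ[fs | m']) ω‖ ≤ 1 := by
    have hup : μ[fs | m'] ≤ᵐ[μ] μ[(fun _ => (1 : ℝ)) | m'] :=
      condExp_mono hfs_int (integrable_const _) (Eventually.of_forall fun ω => by
        rw [hfs]; by_cases hω : ω ∈ s <;> simp [Set.indicator, hω])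
    have hlo : μ[(fun _ => (0 : ℝ)) | m'] ≤ᵐ[μ] μ[fs | m'] :=
      condExp_mono (integrable_const _) hfs_int (Eventually.of_forall fun ω => by
        rw [hfs]; by_cases hω : ω ∈ s <;> simp [Set.indicator, hω])
    filter_upwards [hup, hlo] with ω hωu hωl
    rw [condExp_const hm' (1 : ℝ)] at hωu
    rw [condExp_const hm' (0 : ℝ)] at hωl
    rw [Real.norm_eq_abs, abs_le]
    exact ⟨by linarith, hωu⟩
  have h3 : μ[ft * μ[fs | m'] | m'] =ᵐ[μ] μ[fs | m'] * μ[ft | m'] := by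
    have hcomm : ft * μ[fs | m'] = μ[fs | m'] * ft := mul_comm _ _
    rw [hcomm]
    exact condExp_stronglyMeasurable_mul_of_bound hm' hcond_meas hft_int 1 hcond_bound
  exact (h1.trans h2).trans h3

end Splitting

/-! ### The σ-algebras of item 11236 are the tree's `fieldSigma` / `germSigma` -/

section Sigma

variable {E : Type*} [NormedAddCommGroup E] [NormedSpace ℝ E]

/-- The region σ-algebra written as a double supremum (item 11236) is `fieldSigma`. [folklore] -/
theorem sig_eq_fieldSigma (A : Set E) :
    (⨆ (f : SchwartzMap E ℝ) (_ : tsupport ⇑f ⊆ A),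
        MeasurableSpace.comap (fun ω : FieldConfig E => ω f) (borel ℝ)) = fieldSigma A := by
  unfold fieldSigma
  rw [iSup_subtype']
  rfl

/-- The germ σ-algebra written as a double infimum over `ε > 0` (item 11236) is `germSigma`.
[folklore] -/
theorem germ_eq_germSigma (A : Set E) :
    (⨅ (ε : ℝ) (_ : 0 < ε), fieldSigma (E := E) (Metric.thickening ε A)) = germSigma A := by
  unfold germSigma
  rw [iInf_subtype']

end Sigma

/-! ### The stub from crux 11236 -/

/-- **`stub_markovInheritance` follows from crux stmt-CriticalPhenomena-11236
(`MarkovRigidity.MarkovInheritance`).**  Under the stub's hypotheses (a normalised non-degenerate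
translation-invariant scale-covariant pointwise limit `S = (√A)ⁿ·W_Δ` of `criticalCorr 3` realised by a
Gaussian probability law `μ` with all moments, exponential moments and moment densities `S`), item 11236
gives, for every open ball `U`, `E[F | 𝒜₊(Uᶜ) ∨ 𝒜₊(∂U)] = E[F | 𝒜₊(∂U)]` for bounded `𝒜₊(Ū)`-measurable `F`;
since `∂U ⊆ Uᶜ` the left σ-algebra is `𝒜₊(Uᶜ)`, and `condIndepCondExp_of_condExp_indicator_eq` turns
this one-sided form into the splitting of `𝒜₊(Ū)` and `𝒜₊(Uᶜ)` by `𝒜₊(∂U)`. (The Gaussianity and the explicit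
form of `S` are not needed.) [cite: Rozanov1982, Ch. 2 §1.1 (1.1)–(1.3) and §1.3 (1.28)] -/
theorem stub_markovInheritance_of_markovInheritance :
    Summit.CriticalPhenomena.Ising3DConformalLimit.Theses.MarkovRigidity.MarkovInheritance → ∀ (ρ : ℝ → ℝ) (Δ A : ℝ) (S : Literature.Probability.LatticeModels.CorrFamily 3) (μ : MeasureTheory.Measure (Literature.MathematicalPhysics.QuantumLattice.FieldConfig (EuclideanSpace ℝ (Fin 3)))), (∀ δ ∈ Set.Ioc (0:ℝ) 1, 0 < ρ δ) → Literature.Probability.LatticeModels.HasPointwiseScalingLimit (Literature.Probability.LatticeModels.criticalCorr 3) ρ S → (∀ n z, z ∉ Literature.Probability.LatticeModels.NonCoincident 3 n → S n z = 0) → Literature.Probability.LatticeModels.IsNondegenerateTwoPoint S → Literature.Probability.LatticeModels.IsTranslationInvariant S → Literature.Probability.LatticeModels.IsScaleCovariant Δ S → 0 < A → (∀ (n : ℕ) (x : Fin n → EuclideanSpace ℝ (Fin 3)), S n x = Real.sqrt A ^ n * Summit.CriticalPhenomena.Ising3DConformalLimit.MoebiusLimitExistsOnlyInteraction.wickPower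 Δ n x) → MeasureTheory.IsProbabilityMeasure μ → Literature.MathematicalPhysics.QuantumLattice.HasAllMoments μ → (∀ f : SchwartzMap (EuclideanSpace ℝ (Fin 3)) ℝ, MeasureTheory.Integrable (fun ω : Literature.MathematicalPhysics.QuantumLattice.FieldConfig (EuclideanSpace ℝ (Fin 3)) => Real.exp (ω f)) μ) → (∀ (n : ℕ) (f : Fin n → SchwartzMap (EuclideanSpace ℝ (Fin 3)) ℝ), Literature.MathematicalPhysics.QuantumLattice.moment μ n f = ∫ x : Fin n → EuclideanSpace ℝ (Fin 3), S n x * ∏ i, f i (x i)) → Literature.MathematicalPhysics.QuantumLattice.IsGaussianField μ → ∀ (c : EuclideanSpace ℝ (Fin 3)) (r : ℝ), 0 < r → Literature.MathematicalPhysics.QuantumLattice.CondIndepCondExp (Literature.MathematicalPhysics.QuantumLattice.germSigma (frontier (Metric.ball c r))) (Literature.MathematicalPhysics.QuantumLattice.germSigma (closure (Metric.ball c r))) (Literature.MathematicalPhysics.QuantumLattice.germSigma (Metric.ball c r)ᶜ) μ := by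
  intro hMI ρ Δ A S μ hρ hlim hzero hnd htr hsc _hA _hS hμP hall hexp hmom _hG c r _hr
  -- the σ-algebra family of item 11236 and its identification with `fieldSigma`
  set sig : Set (EuclideanSpace ℝ (Fin 3)) → MeasurableSpace (FieldConfig (EuclideanSpace ℝ (Fin 3))) :=
    fun B => ⨆ (f : SchwartzMap (EuclideanSpace ℝ (Fin 3)) ℝ) (_ : tsupport ⇑f ⊆ B),
      MeasurableSpace.comap (fun ω : FieldConfig (EuclideanSpace ℝ (Fin 3)) => ω f) (borel ℝ) with hsig
  have hsigF : ∀ B, sig B = fieldSigma B := fun B => sig_eq_fieldSigma B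
  have hgerm : ∀ B : Set (EuclideanSpace ℝ (Fin 3)),
      (⨅ (ε : ℝ) (_ : 0 < ε), sig (Metric.thickening ε B)) = germSigma B := by
    intro B
    simp only [hsigF]
    exact germ_eq_germSigma B
  set U : Set (EuclideanSpace ℝ (Fin 3)) := Metric.ball c r with hU
  have hball : (∃ (c' : EuclideanSpace ℝ (Fin 3)) (r' : ℝ), U = Metric.ball c' r') ∨
      (∃ (v : EuclideanSpace ℝ (Fin 3)) (a : ℝ), v ≠ 0 ∧ U = {x | a < inner ℝ x v}) :=
    Or.inl ⟨c, r, rfl⟩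
  have h11236 := hMI ρ Δ S μ hρ hlim hzero hnd htr hsc hμP hall hexp hmom sig hsig U hball
  -- the germ σ-algebras appearing in item 11236, rewritten
  have hin : (⨅ (ε : ℝ) (_ : 0 < ε), sig (Metric.thickening ε U)) = germSigma (closure U) := by
    rw [hgerm U, ← germSigma_closure]
  have hout : (⨅ (ε : ℝ) (_ : 0 < ε), sig (Metric.thickening ε Uᶜ)) = germSigma Uᶜ := hgerm Uᶜ
  have hbd : (⨅ (ε : ℝ) (_ : 0 < ε), sig (Metric.thickening ε (frontier U))) = germSigma (frontier U) :=
    hgerm (frontier U)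
  have hfr_sub : frontier U ⊆ Uᶜ := by
    rw [Metric.isOpen_ball.frontier_eq]
    exact fun x hx => hx.2
  have hsup : germSigma Uᶜ ⊔ germSigma (frontier U) = germSigma Uᶜ :=
    sup_eq_left.2 (germSigma_mono hfr_sub)
  -- apply the general splitting lemma
  refine condIndepCondExp_of_condExp_indicator_eq (germSigma_le _) (germSigma_le _) (germSigma_le _)
    (germSigma_mono hfr_sub) fun s hs => ?_
  have hmeasF : @Measurable _ _ (⨅ (ε : ℝ) (_ : 0 < ε), sig (Metric.thickening ε U)) _
      (s.indicator fun _ => (1 : ℝ)) := by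
    rw [hin]
    exact (measurable_const (a := (1 : ℝ))).indicator hs
  have hbdd : ∃ C : ℝ, ∀ ω, |s.indicator (fun _ => (1 : ℝ)) ω| ≤ C :=
    ⟨1, fun ω => by by_cases hω : ω ∈ s <;> simp [Set.indicator, hω]⟩
  have h := h11236 (s.indicator fun _ => (1 : ℝ)) hmeasF hbdd
  rw [hout, hbd, hsup] at h
  exact h

end Summit.CriticalPhenomena.Ising3DConformalLimit.Cruxes.GaussianLimitIsFree.Birth

end
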